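import Summits.QuantumFields.YangMills.Theses.FradkinShenkerFlow
import Literature.MathematicalPhysics.QuantumFieldTheory.ConstructiveQFTWave0OddRPProofs
import Literature.MathematicalPhysics.QuantumFieldTheory.LatticeGaugeStaticPotentialProofs
import Literature.MathematicalPhysics.QuantumFieldTheory.LatticeGaugeProofs

/-!
# Candidate proof of STUB 2a `stub_rpCauchySchwarz` (line `sup-axis-reflection-transfer`, crux stmt-QuantumFields-9442)

`OddTorusRPAllPlanes → OddTorusRPCauchySchwarz`: the transported reflection `Θ = Φ ∘ Θ₀ ∘ Φ⁻¹` is a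
`wilsonMeasure`-preserving involution (`wilsonMeasure_map_timeReflect` below, from `WilsonRP.plaqRe_timeReflect` +
`WilsonRP.measurePreserving_timeReflect`; conjugated by the proved torus symmetries), so `E[H∘Θ] = E H` and
`cov(H∘Θ, H) = ∫ (H̃∘Θ) H̃` with `H̃ = H − E H` in the same half-space class: positivity is STUB 1 applied to `H̃`;
the form is symmetric (`covariance_map_equiv` along `Θ` + `covariance_comm`) and bilinear, and the discriminant of
`t ↦ cov((F + tG')∘Θ, F + tG') ≥ 0` gives Cauchy–Schwarz (`discrim_le_zero`).
drefute seat refuter-drefute-stmt-QuantumFields-9442-0 (positive by-product, attached as item evidence; a prover lands it).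
-/

noncomputable section

open MeasureTheory ProbabilityTheory
open Literature.MathematicalPhysics.QuantumFieldTheory

namespace Summit.QuantumFields.YangMills.Cruxes.FiniteSusceptibilityWeakCoupling.SupAxisReflectionTransfer.RPCauchySchwarzProof

/-! ## Time reflection preserves the torus Wilson state (every `L`) -/

section TimeReflect

variable {d L N : ℕ} [NeZero d] [NeZero L] {G : Type*} [Group G] [TopologicalSpace G]
  [IsTopologicalGroup G] [CompactSpace G] [MeasurableSpace G] [BorelSpace G]

omit [NeZero L] [TopologicalSpace G] [IsTopologicalGroup G] [CompactSpace G] [MeasurableSpace G]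
  [BorelSpace G] in
/-- `Θ₀` is an involution on configurations. [folklore] -/
theorem timeReflect_timeReflect (U : GaugeConfig d L G) : U.timeReflect.timeReflect = U := by
  funext e
  have h2 : (WilsonRP.edgeReflect e).2 = e.2 := by
    unfold WilsonRP.edgeReflect
    split_ifs with h <;> simp [h]
  rw [WilsonRP.timeReflect_apply, WilsonRP.timeReflect_apply, h2]
  split_ifs with h
  · rw [WilsonRP.edgeReflect_edgeReflect, inv_inv]
  · rw [WilsonRP.edgeReflect_edgeReflect]

omit [NeZero L] [CompactSpace G] in
/-- `Θ₀` as a measurable equivalence. [folklore] -/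
def timeReflectEquiv : GaugeConfig d L G ≃ᵐ GaugeConfig d L G where
  toFun := GaugeConfig.timeReflect
  invFun := GaugeConfig.timeReflect
  left_inv := timeReflect_timeReflect
  right_inv := timeReflect_timeReflect
  measurable_toFun := WilsonRP.measurable_timeReflect
  measurable_invFun := WilsonRP.measurable_timeReflect

omit [MeasurableSpace G] [BorelSpace G] in
/-- The Wilson action is invariant under `Θ₀` (plaquettes are permuted, `Re tr` of temporal ones conjugated).
[folklore] -/
theorem wilsonAction_timeReflect (ρ : G →* Matrix (Fin N) (Fin N) ℂ) (hρ : Continuous ρ)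
    (U : GaugeConfig d L G) : wilsonAction ρ U.timeReflect = wilsonAction ρ U := by
  rw [WilsonRP.wilsonAction_eq, WilsonRP.wilsonAction_eq]
  congr 1
  simp_rw [WilsonRP.plaqRe_timeReflect ρ hρ]
  exact Fintype.sum_equiv WilsonRP.plaqReflectEquiv _ _ fun p => rfl

/-- **The torus Wilson state is invariant under the time reflection `Θ₀`** (every `L`, every `β`). [folklore] -/
theorem wilsonMeasure_map_timeReflect (ρ : G →* Matrix (Fin N) (Fin N) ℂ) (hρ : Continuous ρ) (β : ℝ) :
    (wilsonMeasure (d := d) (L := L) ρ β).map GaugeConfig.timeReflect =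
      wilsonMeasure (d := d) (L := L) (G := G) ρ β := by
  have hπ : (Measure.pi fun _ : Edge d L => haarProbability G).map (timeReflectEquiv (G := G)) =
      Measure.pi fun _ : Edge d L => haarProbability G :=
    (WilsonRP.measurePreserving_timeReflect (d := d) (L := L) (G := G)).map_eq
  change (wilsonMeasure ρ β).map (timeReflectEquiv (G := G)) = _
  simp only [wilsonMeasure, Measure.map_smul, wilsonWeight]
  rw [withDensity_map_of_measurableEquiv _ _ _ hπ]
  intro U
  change ENNReal.ofReal (Real.exp (-β * wilsonAction ρ U.timeReflect)) = _
  rw [wilsonAction_timeReflect ρ hρ]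

end TimeReflect

/-! ## The stub -/

/-- **STUB 2a (`OddTorusRPAllPlanes → OddTorusRPCauchySchwarz`), verbatim statement of the registered
`stub_rpCauchySchwarz`.** [folklore] -/
theorem rpCauchySchwarz : (∀ (G : Type) [Group G] [TopologicalSpace G] [IsTopologicalGroup G] [CompactSpace G] [MeasurableSpace G] [BorelSpace G] (N : ℕ) (ρ : G →* Matrix (Fin N) (Fin N) ℂ), Continuous ρ → ∀ (β : ℝ), 0 ≤ β → ∀ (S : ℕ), 1 ≤ S → ∀ (π : Equiv.Perm (Fin 4)) (v : Literature.MathematicalPhysics.QuantumFieldTheory.Site 4 (2 * S + 1)) (F : Literature.MathematicalPhysics.QuantumFieldTheory.GaugeConfig 4 (2 * S + 1) G → ℝ), Measurable F → (∃ C : ℝ, ∀ U, |F U| ≤ C) → DependsOn F {e : Literature.MathematicalPhysics.QuantumFieldTheory.Edge 4 (2 * S + 1) | Literature.MathematicalPhysics.QuantumFieldTheory.WilsonOddRP.IsOPosEdge (Literature.MathematicalPhysics.QuantumFieldTheory.sitePerm π.symm (e.1 - v), π.symm e.2) ∨ Literature.MathematicalPhysics.QuantumFieldTheory.WilsonOddRP.IsOSharedEdge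 (Literature.MathematicalPhysics.QuantumFieldTheory.sitePerm π.symm (e.1 - v), π.symm e.2)} → 0 ≤ ∫ U, F (Literature.MathematicalPhysics.QuantumFieldTheory.torusConfigShift v (Literature.MathematicalPhysics.QuantumFieldTheory.configPerm π (Literature.MathematicalPhysics.QuantumFieldTheory.GaugeConfig.timeReflect (Literature.MathematicalPhysics.QuantumFieldTheory.configPerm π.symm (Literature.MathematicalPhysics.QuantumFieldTheory.torusConfigShift (-v) U))))) * F U ∂(Literature.MathematicalPhysics.QuantumFieldTheory.wilsonMeasure (d := 4) (L := 2 * S + 1) ρ β)) → ∀ (G : Type) [Group G] [TopologicalSpace G] [IsTopologicalGroup G] [CompactSpace G] [MeasurableSpace G] [BorelSpace G] (N : ℕ) (ρ : G →* Matrix (Fin N) (Fin N) ℂ), Continuous ρ → ∀ (β : ℝ), 0 ≤ β → ∀ (S : ℕ), 1 ≤ S → ∀ (π : Equiv.Perm (Fin 4)) (v : Literature.MathematicalPhysics.QuantumFieldTheory.Site 4 (2 * S + 1)) (F G' : Literature.MathematicalPhysics.QuantumFieldTheory.GaugeConfig 4 (2 * S + 1) G → ℝ), Measurable F → Measurable G'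 → (∃ C : ℝ, ∀ U, |F U| ≤ C) → (∃ C : ℝ, ∀ U, |G' U| ≤ C) → DependsOn F {e : Literature.MathematicalPhysics.QuantumFieldTheory.Edge 4 (2 * S + 1) | Literature.MathematicalPhysics.QuantumFieldTheory.WilsonOddRP.IsOPosEdge (Literature.MathematicalPhysics.QuantumFieldTheory.sitePerm π.symm (e.1 - v), π.symm e.2) ∨ Literature.MathematicalPhysics.QuantumFieldTheory.WilsonOddRP.IsOSharedEdge (Literature.MathematicalPhysics.QuantumFieldTheory.sitePerm π.symm (e.1 - v), π.symm e.2)} → DependsOn G' {e : Literature.MathematicalPhysics.QuantumFieldTheory.Edge 4 (2 * S + 1) | Literature.MathematicalPhysics.QuantumFieldTheory.WilsonOddRP.IsOPosEdge (Literature.MathematicalPhysics.QuantumFieldTheory.sitePerm π.symm (e.1 - v), π.symm e.2) ∨ Literature.MathematicalPhysics.QuantumFieldTheory.WilsonOddRP.IsOSharedEdge (Literature.MathematicalPhysics.QuantumFieldTheory.sitePerm π.symm (e.1 - v), π.symm e.2)} → 0 ≤ ProbabilityTheory.covariance (fun U => F (Literature.MathematicalPhysics.QuantumFieldTheory.torusConfigShift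 v (Literature.MathematicalPhysics.QuantumFieldTheory.configPerm π (Literature.MathematicalPhysics.QuantumFieldTheory.GaugeConfig.timeReflect (Literature.MathematicalPhysics.QuantumFieldTheory.configPerm π.symm (Literature.MathematicalPhysics.QuantumFieldTheory.torusConfigShift (-v) U)))))) F (Literature.MathematicalPhysics.QuantumFieldTheory.wilsonMeasure (d := 4) (L := 2 * S + 1) ρ β) ∧ 0 ≤ ProbabilityTheory.covariance (fun U => G' (Literature.MathematicalPhysics.QuantumFieldTheory.torusConfigShift v (Literature.MathematicalPhysics.QuantumFieldTheory.configPerm π (Literature.MathematicalPhysics.QuantumFieldTheory.GaugeConfig.timeReflect (Literature.MathematicalPhysics.QuantumFieldTheory.configPerm π.symm (Literature.MathematicalPhysics.QuantumFieldTheory.torusConfigShift (-v) U)))))) G' (Literature.MathematicalPhysics.QuantumFieldTheory.wilsonMeasure (d := 4) (L := 2 * S + 1) ρ β) ∧ (ProbabilityTheory.covariance (fun U => F (Literature.MathematicalPhysics.QuantumFieldTheory.torusConfigShift v (Literature.MathematicalPhysics.QuantumFieldTheory.configPerm π (Literature.MathematicalPhysics.QuantumFieldTheory.GaugeConfig.timeReflect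 (Literature.MathematicalPhysics.QuantumFieldTheory.configPerm π.symm (Literature.MathematicalPhysics.QuantumFieldTheory.torusConfigShift (-v) U)))))) G' (Literature.MathematicalPhysics.QuantumFieldTheory.wilsonMeasure (d := 4) (L := 2 * S + 1) ρ β)) ^ 2 ≤ ProbabilityTheory.covariance (fun U => F (Literature.MathematicalPhysics.QuantumFieldTheory.torusConfigShift v (Literature.MathematicalPhysics.QuantumFieldTheory.configPerm π (Literature.MathematicalPhysics.QuantumFieldTheory.GaugeConfig.timeReflect (Literature.MathematicalPhysics.QuantumFieldTheory.configPerm π.symm (Literature.MathematicalPhysics.QuantumFieldTheory.torusConfigShift (-v) U)))))) F (Literature.MathematicalPhysics.QuantumFieldTheory.wilsonMeasure (d := 4) (L := 2 * S + 1) ρ β) * ProbabilityTheory.covariance (fun U => G' (Literature.MathematicalPhysics.QuantumFieldTheory.torusConfigShift v (Literature.MathematicalPhysics.QuantumFieldTheory.configPerm π (Literature.MathematicalPhysics.QuantumFieldTheory.GaugeConfig.timeReflect (Literature.MathematicalPhysics.QuantumFieldTheory.configPerm π.symm (Literature.MathematicalPhysics.QuantumFieldTheory.torusConfigShift (-v)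 U)))))) G' (Literature.MathematicalPhysics.QuantumFieldTheory.wilsonMeasure (d := 4) (L := 2 * S + 1) ρ β) := by
  intro hRP G _ _ _ _ _ _ N ρ hρ β hβ S hS π v F G' hFm hGm hFb hGb hFdep hGdep
  haveI : IsProbabilityMeasure (wilsonMeasure (d := 4) (L := 2 * S + 1) ρ β) :=
    isProbabilityMeasure_wilsonMeasure _ hρ β
  -- the transported reflection, an involution preserving the Wilson state
  set Θ : GaugeConfig 4 (2 * S + 1) G → GaugeConfig 4 (2 * S + 1) G := fun U =>
    torusConfigShift v (configPerm π (GaugeConfig.timeReflect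
      (configPerm π.symm (torusConfigShift (-v) U)))) with hΘ_def
  have hinv1 : ∀ X : GaugeConfig 4 (2 * S + 1) G,
      configPerm π.symm (torusConfigShift (-v) (torusConfigShift v (configPerm π X))) = X := by
    intro X
    funext x
    simp only [configPerm_apply, torusConfigShift_apply, Equiv.symm_symm, sub_neg_eq_add,
      add_sub_cancel_right]
    have h1 : sitePerm π.symm (sitePerm π x.1) = x.1 := by ext j; simp
    rw [h1, Equiv.symm_apply_apply]
  have hinv2 : ∀ U : GaugeConfig 4 (2 * S + 1) G,
      torusConfigShift v (configPerm π (configPerm π.symm (torusConfigShift (-v) U))) = U := by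
    intro U
    funext x
    simp only [configPerm_apply, torusConfigShift_apply, Equiv.symm_symm, sub_neg_eq_add]
    have h1 : sitePerm π (sitePerm π.symm (x.1 - v)) + v = x.1 := by ext j; simp
    rw [h1, Equiv.apply_symm_apply]
  have hΘΘ : ∀ U, Θ (Θ U) = U := by
    intro U
    simp only [hΘ_def, hinv1, timeReflect_timeReflect, hinv2]
  have hΘm : Measurable Θ :=
    (torusConfigShift v).measurable.comp ((configPerm π).measurable.comp
      (WilsonRP.measurable_timeReflect.comp ((configPerm π.symm).measurable.comp
        (torusConfigShift (-v)).measurable)))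
  set Θe : GaugeConfig 4 (2 * S + 1) G ≃ᵐ GaugeConfig 4 (2 * S + 1) G :=
    { toFun := Θ, invFun := Θ, left_inv := hΘΘ, right_inv := hΘΘ,
      measurable_toFun := hΘm, measurable_invFun := hΘm } with hΘe_def
  have hΘe : (Θe : GaugeConfig 4 (2 * S + 1) G → GaugeConfig 4 (2 * S + 1) G) = Θ := rfl
  have hmap : (wilsonMeasure (d := 4) (L := 2 * S + 1) ρ β).map Θ =
      wilsonMeasure (d := 4) (L := 2 * S + 1) ρ β := by
    have hcomp : Θ = (torusConfigShift v) ∘ ((configPerm π) ∘ (GaugeConfig.timeReflect ∘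
        ((configPerm π.symm) ∘ (torusConfigShift (-v))))) := rfl
    rw [hcomp, ← Measure.map_map (torusConfigShift v).measurable
        ((configPerm π).measurable.comp (WilsonRP.measurable_timeReflect.comp
          ((configPerm π.symm).measurable.comp (torusConfigShift (-v)).measurable))),
      ← Measure.map_map (configPerm π).measurable (WilsonRP.measurable_timeReflect.comp
          ((configPerm π.symm).measurable.comp (torusConfigShift (-v)).measurable)),
      ← Measure.map_map WilsonRP.measurable_timeReflect
          ((configPerm π.symm).measurable.comp (torusConfigShift (-v)).measurable),
      ← Measure.map_map (configPerm π.symm).measurable (torusConfigShift (-v)).measurable,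
      wilsonMeasure_map_torusConfigShift ρ β (-v), wilsonMeasure_map_configPerm ρ hρ β π.symm,
      wilsonMeasure_map_timeReflect ρ hρ β, wilsonMeasure_map_configPerm ρ hρ β π,
      wilsonMeasure_map_torusConfigShift ρ β v]
  have hmapE : (wilsonMeasure (d := 4) (L := 2 * S + 1) ρ β).map Θe =
      wilsonMeasure (d := 4) (L := 2 * S + 1) ρ β := by rw [hΘe, hmap]
  -- Θ preserves means
  have hmean : ∀ H : GaugeConfig 4 (2 * S + 1) G → ℝ,
      ∫ U, H (Θ U) ∂(wilsonMeasure (d := 4) (L := 2 * S + 1) ρ β) =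
        ∫ U, H U ∂(wilsonMeasure (d := 4) (L := 2 * S + 1) ρ β) := by
    intro H
    have h := integral_map_equiv (μ := wilsonMeasure (d := 4) (L := 2 * S + 1) ρ β) Θe H
    rw [hmapE] at h
    exact h.symm
  -- positivity of the centred form on the half-space class
  have hpsd : ∀ H : GaugeConfig 4 (2 * S + 1) G → ℝ, Measurable H → (∃ C : ℝ, ∀ U, |H U| ≤ C) →
      DependsOn H {e : Edge 4 (2 * S + 1) |
        WilsonOddRP.IsOPosEdge (sitePerm π.symm (e.1 - v), π.symm e.2) ∨
          WilsonOddRP.IsOSharedEdge (sitePerm π.symm (e.1 - v), π.symm e.2)} →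
      0 ≤ cov[fun U => H (Θ U), H; wilsonMeasure (d := 4) (L := 2 * S + 1) ρ β] := by
    intro H hH hHb hHdep
    set c : ℝ := ∫ U, H U ∂(wilsonMeasure (d := 4) (L := 2 * S + 1) ρ β) with hc
    obtain ⟨C, hC⟩ := hHb
    have key := hRP G N ρ hρ β hβ S hS π v (fun U => H U - c) (hH.sub measurable_const)
      ⟨C + |c|, fun U => (abs_sub _ _).trans (by linarith [hC U, le_refl |c|])⟩
      (fun U V hUV => by simp only [hHdep hUV])
    have hcΘ : ∫ U, H (Θ U) ∂(wilsonMeasure (d := 4) (L := 2 * S + 1) ρ β) = c := hmean H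
    simp only [covariance]
    rw [hcΘ]
    exact key
  refine ⟨hpsd F hFm hFb hFdep, hpsd G' hGm hGb hGdep, ?_⟩
  -- symmetry of the form
  have hsym : cov[fun U => G' (Θ U), F; wilsonMeasure (d := 4) (L := 2 * S + 1) ρ β] =
      cov[fun U => F (Θ U), G'; wilsonMeasure (d := 4) (L := 2 * S + 1) ρ β] := by
    calc cov[fun U => G' (Θ U), F; wilsonMeasure (d := 4) (L := 2 * S + 1) ρ β]
        = cov[fun U => G' (Θ U), F; (wilsonMeasure (d := 4) (L := 2 * S + 1) ρ β).map Θe] := by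
          rw [hmapE]
      _ = cov[(fun U => G' (Θ U)) ∘ Θe, F ∘ Θe; wilsonMeasure (d := 4) (L := 2 * S + 1) ρ β] :=
          covariance_map_equiv _ _ Θe
      _ = cov[G', fun U => F (Θ U); wilsonMeasure (d := 4) (L := 2 * S + 1) ρ β] := by
          congr 1
          funext U
          simp only [Function.comp_apply, hΘe, hΘΘ]
      _ = cov[fun U => F (Θ U), G'; wilsonMeasure (d := 4) (L := 2 * S + 1) ρ β] := covariance_comm _ _
  -- square integrability of everything in sight
  have l2 : ∀ H : GaugeConfig 4 (2 * S + 1) G → ℝ, Measurable H → (∃ C : ℝ, ∀ U, |H U| ≤ C) →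
      MemLp H 2 (wilsonMeasure (d := 4) (L := 2 * S + 1) ρ β) ∧
      MemLp (fun U => H (Θ U)) 2 (wilsonMeasure (d := 4) (L := 2 * S + 1) ρ β) := by
    intro H hH hHb
    obtain ⟨C, hC⟩ := hHb
    exact ⟨MemLp.of_bound hH.aestronglyMeasurable C (ae_of_all _ fun U => by
        simpa [Real.norm_eq_abs] using hC U),
      MemLp.of_bound (hH.comp hΘm).aestronglyMeasurable C (ae_of_all _ fun U => by
        simpa [Real.norm_eq_abs] using hC (Θ U))⟩
  obtain ⟨lF, lFΘ⟩ := l2 F hFm hFb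
  obtain ⟨lG, lGΘ⟩ := l2 G' hGm hGb
  -- the quadratic `t ↦ cov((F + tG')∘Θ, F + tG') ≥ 0`
  have hquad : ∀ t : ℝ,
      0 ≤ cov[fun U => G' (Θ U), G'; wilsonMeasure (d := 4) (L := 2 * S + 1) ρ β] * (t * t) +
        (2 * cov[fun U => F (Θ U), G'; wilsonMeasure (d := 4) (L := 2 * S + 1) ρ β]) * t +
        cov[fun U => F (Θ U), F; wilsonMeasure (d := 4) (L := 2 * S + 1) ρ β] := by
    intro t
    obtain ⟨CF, hCF⟩ := hFb
    obtain ⟨CG, hCG⟩ := hGb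
    have h := hpsd (fun U => F U + t * G' U) (hFm.add (hGm.const_mul t))
      ⟨CF + |t| * CG, fun U => (abs_add_le _ _).trans (by
        rw [abs_mul]; nlinarith [hCF U, hCG U, abs_nonneg t, abs_nonneg (G' U)])⟩
      (fun U V hUV => by simp only [hFdep hUV, hGdep hUV])
    have hsplit : cov[fun U => F (Θ U) + t * G' (Θ U), fun U => F U + t * G' U;
        wilsonMeasure (d := 4) (L := 2 * S + 1) ρ β] =
      cov[fun U => F (Θ U), F; wilsonMeasure (d := 4) (L := 2 * S + 1) ρ β] +
        t * cov[fun U => F (Θ U), G'; wilsonMeasure (d := 4) (L := 2 * S + 1) ρ β] +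
        (t * cov[fun U => G' (Θ U), F; wilsonMeasure (d := 4) (L := 2 * S + 1) ρ β] +
          t * (t * cov[fun U => G' (Θ U), G'; wilsonMeasure (d := 4) (L := 2 * S + 1) ρ β])) := by
      have e1 : (fun U => F (Θ U) + t * G' (Θ U)) =
          (fun U => F (Θ U)) + fun U => t * G' (Θ U) := rfl
      have e2 : (fun U => F U + t * G' U) = F + fun U => t * G' U := rfl
      have lGt : MemLp (fun U => t * G' U) 2 (wilsonMeasure (d := 4) (L := 2 * S + 1) ρ β) :=
        lG.const_mul t
      have lGΘt : MemLp (fun U => t * G' (Θ U)) 2 (wilsonMeasure (d := 4) (L := 2 * S + 1) ρ β) :=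
        lGΘ.const_mul t
      rw [e1, e2, covariance_add_left lFΘ lGΘt (lF.add lGt), covariance_add_right lFΘ lF lGt,
        covariance_add_right lGΘt lF lGt, covariance_const_mul_right, covariance_const_mul_left,
        covariance_const_mul_left, covariance_const_mul_right]
    rw [hsplit, hsym] at h
    nlinarith [h]
  have hdisc := discrim_le_zero hquad
  rw [discrim] at hdisc
  nlinarith [hdisc, hpsd F hFm hFb hFdep, hpsd G' hGm hGb hGdep]

end Summit.QuantumFields.YangMills.Cruxes.FiniteSusceptibilityWeakCoupling.SupAxisReflectionTransfer.RPCauchySchwarzProof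

end
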